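import Summits.AtomisticToContinuum.FouriersLaw.Theorems.PhononMeanFreePathCoherentDephasingStrictAbsorption
import Summits.AtomisticToContinuum.FouriersLaw.Theorems.PhononMeanFreePathIncoherentChannelStrictForecastBudget
import Summits.AtomisticToContinuum.FouriersLaw.Theorems.PhononMeanFreePathIncoherentChannelCommonPastBoundHelper2
import Summits.AtomisticToContinuum.FouriersLaw.Theorems.PhononMeanFreePathIncoherentChannelWitnessTimeResolved
import Summits.AtomisticToContinuum.FouriersLaw.Theorems.PhononMeanFreePathIncoherentChannelCoherentBudgetMonotone

/-!
# `N`-UNIFORM ANHARMONIC SHORT-TIME LOSS of the forecast norm below its coherent budget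

Route `PhononMeanFreePath` (sub-problem `FouriersLaw`), crux `IncoherentChannel` (stmt-AtomisticToContinuum-11811), line
`two-horizons-forecast-loss`, lead c7 (registered helper stub `anharmonicShortTimeLoss`; `--supports`, nothing here closes an item).

For the `(N+1)`-site pinned anharmonic chain `pinnedChain ω₂ lam β γ` (all `> 0`) with both Langevin baths at `T > 0`, the
forecast norm `S_N(t) = ‖K_t p_N‖²_{L²(μ₀)}` (`fnorm`), the coherent channel `r_N = pairCorr` and the echo
`a_N(t) = ⟨p_N, K_t p_N⟩_{μ₀}` obey the landed TIME-RESOLVED FORECAST BUDGET `S_N(t) + (2γ/T)∫₀ᵗ(r_N² + a_N²) ≤ T`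
(`forecastBudget_timeResolved`, p136614), which is an IDENTITY at the harmonic corner `lam = β = 0`
(`harmonic_fnorm_sub_eq_integral`, p155138). **Theorem `anharmonicShortTimeLoss`**: for `lam, β > 0` there are `c, r₀ > 0`
INDEPENDENT OF `N ≥ 2` with

  `S_N(t) + (2γ/T) ∫₀ᵗ (r_N(s)² + a_N(s)²) ds ≤ T - c·t⁵`   for all `0 ≤ t ≤ r₀`:

the INCOHERENT dissipation of the forecast (the slack of the Jensen step `⟨p_b, v_s⟩² ≤ T²‖∂_{p_b}v_s‖²` in the Bakry–Émery
identity) is strictly positive at order `t⁵`, uniformly in the length — the first `N`-uniform use of anharmonicity on the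
engine's own object `S_N`.

Proof. By site reflection the statement is about the kick's forecast `u_s = K_s p₀` (`‖u_t‖² = S_N(t)`,
`leftForecastNorm_eq_fnorm`; `⟨p₀,u_s⟩ = a_N(s)`, `echo_eq_momResp_zero`; `⟨p_N,u_s⟩ = r_N(s)`, `sa_reflect`). The
time-resolved witnessed Landauer bound (`witness_timeResolved_lintegral_le`, p158070) with the centred local
curvature `Φ̃ = Φ - ⟨Φ⟩`, `Φ = ω₂ + 3 lam q₀² + 1 + 3β(q₁-q₀)²`, as which-path witness gives
`V·(T/2γ)·S_N(t) + ∫₀ᵗ{V[a_N² + r_N²] + A²} ≤ V T²/(2γ)` with `V = Var_μ(Φ)`, `A(s) = ⟨p₀Φ̃, u_s⟩`; the sibling crux's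
`N`-uniform three-step Dynkin expansion `|A(s) + T V s²/2| ≤ M s³/6` (`expansion_of_cube`, `sa_generatorCube`,
`uniform_localPoly_sq`, `uniform_curvature_sq`, `sa_statics`) and variance floor `V ≥ v₀ > 0` (`sa_varianceFloor`) give
`∫₀ᵗ A² ≥ (T v₀/4)² t⁵/5` on `[0, r₀]`, `r₀ = 3 T v₀/(2M)`; divide by `V·T/(2γ)` and use `V ≤ C_V`:
`c = (2γ/T)(T v₀/4)²/(5 C_V)`. No definition, no `sorry`, standard axioms.
-/

noncomputable section

namespace Summit.AtomisticToContinuum.FouriersLaw.Theorems.PhononMeanFreePath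

open MeasureTheory ProbabilityTheory Filter Topology Set intervalIntegral
open scoped NNReal ENNReal
open Literature.MathematicalPhysics.KineticTheory.HeatConduction
open Literature.MathematicalPhysics.KineticTheory Literature.Probability.Process OscillatorChain
open Summit.AtomisticToContinuum.FouriersLaw.Theorems.CoherentDephasing.StrictAbsorption



/-! ## The real-analysis core -/

/-- **The real-analysis core of the short-time loss.** If at a horizon `t > 0` the time-resolved witnessed bound
`ofReal(V·(T/2γ)·S) + ∫⁻_{(0,t]} ofReal(V(m0² + mN²) + A²) ≤ ofReal(V T²/(2γ))` holds with square-integrable `m0, mN, A`,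
`0 ≤ S`, the witness has the envelope `|A(s) + T V s²/2| ≤ M_N s³/6` (`M_N ≤ M`), `0 < v₀ ≤ V ≤ C_V` and
`t ≤ r₀ = 3 T v₀/(2M)`, then `S + (2γ/T)∫_{(0,t]}(mN² + m0²) ≤ T - (2γ/T)(T v₀/4)²/(5 C_V)·t⁵`. [folklore] -/
theorem shortTime_abstract {γ T V v₀ CV M MN t S : ℝ} (hγ : 0 < γ) (hT : 0 < T) (hv₀ : 0 < v₀) (hVlo : v₀ ≤ V)
    (hVhi : V ≤ CV) (hM : 0 < M) (hMN : MN ≤ M) (ht : 0 < t) (htr : t ≤ 3 * T * v₀ / (2 * M)) (hS : 0 ≤ S)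
    {m0 mN A : ℝ → ℝ}
    (hI0 : IntegrableOn (fun s => m0 s ^ 2) (Ioc 0 t)) (hIN : IntegrableOn (fun s => mN s ^ 2) (Ioc 0 t))
    (hIA : IntegrableOn (fun s => A s ^ 2) (Ioc 0 t))
    (hW : ENNReal.ofReal (V * (T / (2 * γ)) * S) +
        ∫⁻ s in Ioc (0 : ℝ) t, ENNReal.ofReal (V * (m0 s ^ 2 + mN s ^ 2) + A s ^ 2) ≤
      ENNReal.ofReal (V * (T ^ 2 / (2 * γ))))
    (henv : ∀ s, 0 ≤ s → |A s + T * V * s ^ 2 / 2| ≤ MN * s ^ 3 / 6) :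
    S + (2 * γ / T) * ∫ s in Ioc (0 : ℝ) t, (mN s ^ 2 + m0 s ^ 2) ≤
      T - ((2 * γ / T) * ((T * v₀ / 4) ^ 2 / 5) / CV) * t ^ 5 := by
  have hVpos : 0 < V := hv₀.trans_le hVlo
  have hCV : 0 < CV := hVpos.trans_le hVhi
  -- the envelope in one-sided form
  have henv' : ∀ s, 0 ≤ s → A s ≤ -(T * V) * s ^ 2 / 2 + M * s ^ 3 / 6 := by
    intro s hs
    have h1 := (abs_le.1 (henv s hs)).2
    have h2 : MN * s ^ 3 / 6 ≤ M * s ^ 3 / 6 := by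
      have : 0 ≤ s ^ 3 / 6 := by positivity
      nlinarith
    linarith
  -- on `(0, t] ⊆ (0, r₀]` the witness is at least `(T v₀/4) s²` in size
  have hAlow : ∀ s, 0 < s → s ≤ t → (T * v₀ / 4) ^ 2 * s ^ 4 ≤ A s ^ 2 := by
    intro s hs hst
    have hsr : s ≤ 3 * T * v₀ / (2 * M) := hst.trans htr
    have h1 := henv' s hs.le
    have h2 : M * s ^ 3 / 6 ≤ T * v₀ * s ^ 2 / 4 := by
      have : M * s ≤ M * (3 * T * v₀ / (2 * M)) := mul_le_mul_of_nonneg_left hsr hM.le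
      have e : M * (3 * T * v₀ / (2 * M)) = 3 * T * v₀ / 2 := by field_simp
      nlinarith [sq_nonneg s]
    have h3 : T * v₀ * s ^ 2 / 4 ≤ T * V * s ^ 2 / 4 := by
      have := mul_le_mul_of_nonneg_left hVlo hT.le
      nlinarith [sq_nonneg s]
    have h4 : A s ≤ -(T * v₀ / 4 * s ^ 2) := by nlinarith
    have h5 : 0 ≤ T * v₀ / 4 * s ^ 2 := by positivity
    have h6 : T * v₀ / 4 * s ^ 2 ≤ -A s := by linarith
    calc (T * v₀ / 4) ^ 2 * s ^ 4 = (T * v₀ / 4 * s ^ 2) ^ 2 := by ring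
      _ ≤ (-A s) ^ 2 := pow_le_pow_left₀ h5 h6 2
      _ = A s ^ 2 := by ring
  -- from the lower integral to real integrals
  have hfi : IntegrableOn (fun s => V * (m0 s ^ 2 + mN s ^ 2) + A s ^ 2) (Ioc 0 t) :=
    ((hI0.add hIN).const_mul V).add hIA
  have hf0 : 0 ≤ᵐ[volume.restrict (Ioc (0 : ℝ) t)] fun s => V * (m0 s ^ 2 + mN s ^ 2) + A s ^ 2 :=
    ae_of_all _ fun s => add_nonneg (mul_nonneg hVpos.le (add_nonneg (sq_nonneg _) (sq_nonneg _))) (sq_nonneg _)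
  have hRHS0 : 0 ≤ V * (T ^ 2 / (2 * γ)) := mul_nonneg hVpos.le (by positivity)
  have ha0 : 0 ≤ V * (T / (2 * γ)) * S := mul_nonneg (mul_nonneg hVpos.le (by positivity)) hS
  have hb0 : 0 ≤ ∫ s in Ioc (0 : ℝ) t, (V * (m0 s ^ 2 + mN s ^ 2) + A s ^ 2) := integral_nonneg_of_ae hf0
  have hreal : V * (T / (2 * γ)) * S + ∫ s in Ioc (0 : ℝ) t, (V * (m0 s ^ 2 + mN s ^ 2) + A s ^ 2) ≤
      V * (T ^ 2 / (2 * γ)) := by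
    have e := ofReal_integral_eq_lintegral_ofReal hfi hf0
    rw [← e, ← ENNReal.ofReal_add ha0 hb0] at hW
    exact (ENNReal.ofReal_le_ofReal_iff hRHS0).1 hW
  have hsplit : ∫ s in Ioc (0 : ℝ) t, (V * (m0 s ^ 2 + mN s ^ 2) + A s ^ 2) =
      V * (∫ s in Ioc (0 : ℝ) t, (mN s ^ 2 + m0 s ^ 2)) + ∫ s in Ioc (0 : ℝ) t, A s ^ 2 := by
    have j0 : IntegrableOn (fun s => m0 s ^ 2 + mN s ^ 2) (Ioc 0 t) := hI0.add hIN
    have j1 : IntegrableOn (fun s => V * (m0 s ^ 2 + mN s ^ 2)) (Ioc 0 t) := j0.const_mul V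
    have e1 : ∫ s in Ioc (0 : ℝ) t, (V * (m0 s ^ 2 + mN s ^ 2) + A s ^ 2) =
        (∫ s in Ioc (0 : ℝ) t, V * (m0 s ^ 2 + mN s ^ 2)) + ∫ s in Ioc (0 : ℝ) t, A s ^ 2 := integral_add j1 hIA
    have e2 : ∫ s in Ioc (0 : ℝ) t, V * (m0 s ^ 2 + mN s ^ 2) = V * ∫ s in Ioc (0 : ℝ) t, (m0 s ^ 2 + mN s ^ 2) :=
      integral_const_mul _ _
    have e3 : ∫ s in Ioc (0 : ℝ) t, (m0 s ^ 2 + mN s ^ 2) = ∫ s in Ioc (0 : ℝ) t, (mN s ^ 2 + m0 s ^ 2) :=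
      integral_congr_ae (ae_of_all _ fun s => add_comm _ _)
    rw [e1, e2, e3]
  -- the short-time lower bound on the witness term
  have hAint : (T * v₀ / 4) ^ 2 * t ^ 5 / 5 ≤ ∫ s in Ioc (0 : ℝ) t, A s ^ 2 := by
    have hpoly : IntegrableOn (fun s : ℝ => (T * v₀ / 4) ^ 2 * s ^ 4) (Ioc 0 t) :=
      (by fun_prop : Continuous fun s : ℝ => (T * v₀ / 4) ^ 2 * s ^ 4).integrableOn_Ioc
    have hmono : ∫ s in Ioc (0 : ℝ) t, (T * v₀ / 4) ^ 2 * s ^ 4 ≤ ∫ s in Ioc (0 : ℝ) t, A s ^ 2 :=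
      setIntegral_mono_on hpoly hIA measurableSet_Ioc
        fun s hs => hAlow s (Set.mem_Ioc.1 hs).1 (Set.mem_Ioc.1 hs).2
    have hval : ∫ s in Ioc (0 : ℝ) t, (T * v₀ / 4) ^ 2 * s ^ 4 = (T * v₀ / 4) ^ 2 * t ^ 5 / 5 := by
      rw [← intervalIntegral.integral_of_le ht.le, intervalIntegral.integral_const_mul, integral_pow]
      norm_num
      ring
    linarith
  -- conclusion
  set I : ℝ := ∫ s in Ioc (0 : ℝ) t, (mN s ^ 2 + m0 s ^ 2) with hI
  set X : ℝ := (T * v₀ / 4) ^ 2 * t ^ 5 / 5 with hX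
  have hX0 : 0 ≤ X := by rw [hX]; positivity
  have hmain : V * (T / (2 * γ)) * S + V * I ≤ V * (T ^ 2 / (2 * γ)) - X := by rw [hsplit] at hreal; linarith
  -- divide by `V·T/(2γ) > 0`
  have hc0 : 0 < T / (2 * γ) := by positivity
  have hdiv : S + (2 * γ / T) * I ≤ T - (2 * γ / T) * X / V := by
    have h1 : V * (T / (2 * γ)) * (S + (2 * γ / T) * I) ≤ V * (T / (2 * γ)) * (T - (2 * γ / T) * X / V) := by
      have e1 : V * (T / (2 * γ)) * (S + (2 * γ / T) * I) = V * (T / (2 * γ)) * S + V * I := by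
        field_simp
      have e2 : V * (T / (2 * γ)) * (T - (2 * γ / T) * X / V) = V * (T ^ 2 / (2 * γ)) - X := by
        field_simp
      rw [e1, e2]; exact hmain
    exact le_of_mul_le_mul_left h1 (mul_pos hVpos hc0)
  have h2 : (2 * γ / T) * X / CV ≤ (2 * γ / T) * X / V :=
    div_le_div_of_nonneg_left (by positivity) hVpos hVhi
  have e3 : ((2 * γ / T) * ((T * v₀ / 4) ^ 2 / 5) / CV) * t ^ 5 = (2 * γ / T) * X / CV := by
    rw [hX]; ring
  rw [e3]
  linarith

/-! ## The item-level theorem -/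

/-- **`N`-UNIFORM ANHARMONIC SHORT-TIME LOSS (registered helper stub `anharmonicShortTimeLoss`).** For the pinned
anharmonic chain (`ω₂, lam, β, γ > 0`) with both baths at `T > 0` there are `c, r₀ > 0`, independent of the length, such that
for every `N ≥ 2` and `0 ≤ t ≤ r₀`:
`S_N(t) + (2γ/T)∫_{(0,t]}(r_N(s)² + a_N(s)²) ds ≤ T - c t⁵` — the forecast norm falls strictly below its coherent budget
(which it saturates identically at `lam = β = 0`). [folklore] -/
theorem anharmonicShortTimeLoss : ∀ ω₂ lam β γ : ℝ, 0 < ω₂ → 0 < lam → 0 < β → 0 < γ → ∀ T : ℝ, 0 < T → ∃ c r₀ : ℝ, 0 < c ∧ 0 < r₀ ∧ ∀ N : ℕ, 2 ≤ N → ∀ t : ℝ, 0 ≤ t → t ≤ r₀ → fnorm ω₂ lam β γ T N t + (2 * γ / T) * ∫ s in Ioc (0 : ℝ) t, ((pairCorr ω₂ lam β γ T N s) ^ 2 + (∫ z, z.2 (Fin.last N) * fcast ω₂ lam β γ T N s z ∂((pinnedChain ω₂ lam β γ).gibbsMeasure (N + 1) T)) ^ 2) ≤ T - c * t ^ 5 :=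 by
  intro ω₂ lam β γ hω hl hβ hγ T hT
  -- `N`-uniform constants (the sibling crux's strict-absorption data)
  obtain ⟨v₀, hv₀, hvar⟩ := sa_varianceFloor ω₂ lam β γ hω hl hβ hγ T hT
  obtain ⟨C₃, hcube⟩ := sa_generatorCube ω₂ lam β γ hω hl hβ hγ T hT
  obtain ⟨CV, hCV, huc⟩ := uniform_curvature_sq hω hl.le hβ hT
  obtain ⟨C₆, hC₆, hloc⟩ := uniform_localPoly_sq hω hl.le hβ hT
  set MG : ℝ := 2 * C₃ ^ 2 * (1 + 36 * C₆) with hMG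
  have hMG0 : 0 ≤ MG := by positivity
  set M : ℝ := (T * CV + MG) / 2 + 1 with hM
  have hM0 : 0 < M := by positivity
  set c : ℝ := (2 * γ / T) * ((T * v₀ / 4) ^ 2 / 5) / CV with hc
  have hc0 : 0 < c := by rw [hc]; positivity
  set r₀ : ℝ := 3 * T * v₀ / (2 * M) with hr₀
  have hr₀0 : 0 < r₀ := by rw [hr₀]; positivity
  refine ⟨c, r₀, hc0, hr₀0, fun N hN t ht0 htr => ?_⟩
  rcases ht0.eq_or_lt with h0 | ht
  · -- `t = 0`: the window is empty and `S_N(0) ≤ T`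
    subst h0
    have hdict := commonPastBound_forecastDictionary ω₂ lam β γ hω hl.le hβ.le hγ.le T hT N
    have hS := (hdict.2.2.2.2 0).2.1
    simp only [Set.Ioc_self, Measure.restrict_empty, integral_zero_measure, mul_zero, add_zero,
      ne_eq, OfNat.ofNat_ne_zero, not_false_eq_true, zero_pow, sub_zero]
    exact hS
  -- `t > 0`: the chain of length `N + 1`
  have hNp : 0 < N + 1 := Nat.succ_pos N
  have hH0 : ∀ y, 0 ≤ (pinnedChain ω₂ lam β γ).hamiltonian (N + 1) y := fun y =>
    pinnedChain_hamiltonian_nonneg hω.le hl.le hβ.le γ (N + 1) y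
  haveI : IsProbabilityMeasure ((pinnedChain ω₂ lam β γ).gibbsMeasure (N + 1) T) :=
    pinnedChain_isProbabilityMeasure_gibbsMeasure hω hl.le hβ.le γ (N + 1) hT
  obtain ⟨G₃, hG₃c, hgen₃, ⟨B₃, hB₃⟩, hG₃loc⟩ := hcube N hN
  -- sizes of the variance, of the weight `a = p₀Φ̃` and of `G₃`
  have hVlo := hvar N hN
  obtain ⟨hΦi, -, -, hVhi⟩ := huc N hN
  have ha2 := (sa_statics ω₂ lam β γ hω hl hβ hγ T hT N hN).2.2.2
  have hG3 : ∫ z, G₃ z ^ 2 ∂((pinnedChain ω₂ lam β γ).gibbsMeasure (N + 1) T) ≤ MG := (hloc N hN G₃ C₃ hG₃c hG₃loc).2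
  -- the which-path expansion of the witness
  have henv := expansion_of_cube hω hl hβ hγ hT hN hG₃c hgen₃ hB₃
  -- the curvature bound `|Φ| ≤ CΦ (1 + H)` and the centred witness `g = Φ - Φ̄`
  set CΦ : ℝ := (ω₂ + 1) + 6 * lam / ω₂ + 6 * β with hCΦ
  have hCΦ0 : 0 ≤ CΦ := by rw [hCΦ]; positivity
  have hΦb : ∀ z : PhaseSpace (N + 1), |ω₂ + 3 * lam * z.1 0 ^ 2 + 1 + 3 * β * (z.1 ⟨1, by omega⟩ - z.1 0) ^ 2| ≤
      CΦ * (1 + (pinnedChain ω₂ lam β γ).hamiltonian (N + 1) z) := by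
    intro z
    obtain ⟨h0, h1⟩ := classBd_phi_bounds hω hl.le hβ.le γ hN z
    rw [abs_of_nonneg h0, hCΦ]
    simpa [add_assoc] using h1
  set Φbar : ℝ := ∫ x, (ω₂ + 3 * lam * x.1 0 ^ 2 + 1 + 3 * β * (x.1 ⟨1, by omega⟩ - x.1 0) ^ 2)
    ∂((pinnedChain ω₂ lam β γ).gibbsMeasure (N + 1) T) with hΦbar
  have hgd : ContDiff ℝ 1 (fun q : Fin (N + 1) → ℝ =>
      (ω₂ + 3 * lam * q 0 ^ 2 + 1 + 3 * β * (q ⟨1, by omega⟩ - q 0) ^ 2) - Φbar) := by fun_prop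
  have hg0 : ∫ z, (fun q : Fin (N + 1) → ℝ =>
      (ω₂ + 3 * lam * q 0 ^ 2 + 1 + 3 * β * (q ⟨1, by omega⟩ - q 0) ^ 2) - Φbar) z.1
      ∂((pinnedChain ω₂ lam β γ).gibbsMeasure (N + 1) T) = 0 := by
    dsimp only
    rw [integral_sub hΦi (integrable_const _), MeasureTheory.integral_const, probReal_univ, one_smul, hΦbar, sub_self]
  have hgb : ∀ z : PhaseSpace (N + 1), |(fun q : Fin (N + 1) → ℝ =>
      (ω₂ + 3 * lam * q 0 ^ 2 + 1 + 3 * β * (q ⟨1, by omega⟩ - q 0) ^ 2) - Φbar) z.1| ≤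
      (CΦ + |Φbar|) * (1 + (pinnedChain ω₂ lam β γ).hamiltonian (N + 1) z) := by
    intro z
    dsimp only
    have h1' := hΦb z
    have h2' : |Φbar| ≤ |Φbar| * (1 + (pinnedChain ω₂ lam β γ).hamiltonian (N + 1) z) := by
      have := hH0 z; nlinarith [abs_nonneg Φbar]
    calc |ω₂ + 3 * lam * z.1 0 ^ 2 + 1 + 3 * β * (z.1 ⟨1, by omega⟩ - z.1 0) ^ 2 - Φbar|
        ≤ |ω₂ + 3 * lam * z.1 0 ^ 2 + 1 + 3 * β * (z.1 ⟨1, by omega⟩ - z.1 0) ^ 2| + |Φbar| := abs_sub _ _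
      _ ≤ CΦ * (1 + (pinnedChain ω₂ lam β γ).hamiltonian (N + 1) z) +
          |Φbar| * (1 + (pinnedChain ω₂ lam β γ).hamiltonian (N + 1) z) := add_le_add h1' h2'
      _ = (CΦ + |Φbar|) * (1 + (pinnedChain ω₂ lam β γ).hamiltonian (N + 1) z) := by ring
  -- the time-resolved witnessed bound at horizon `t`
  have hW := witness_timeResolved_lintegral_le ω₂ lam β γ hω hl.le hβ hγ T hT N (by omega) _ (CΦ + |Φbar|)
    hgd hgb hg0 t ht
  -- read the left forecast norm as `S_N(t)`
  rw [leftForecastNorm_eq_fnorm ω₂ lam β γ hω hl.le hβ.le hγ.le T N t] at hW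
  -- integrability of the three squared correlations on `(0, ∞)`
  have hϑ0 : (0 : ℝ) < 1 / (4 * T) := by positivity
  have h2ϑ : 2 * (1 / (4 * T)) < 1 / T := by
    rw [show 2 * (1 / (4 * T)) = 1 / (2 * T) by field_simp; ring, div_lt_div_iff₀ (by positivity) hT]; nlinarith
  have hp0 : ∫ y, (fun y : PhaseSpace (N + 1) => y.2 0) y ∂((pinnedChain ω₂ lam β γ).gibbsMeasure (N + 1) T) = 0 :=
    CoherentDephasing.pinnedChain_integral_momentum_gibbsMeasure (N + 1) T 0
  have hwb : ∀ (i : Fin (N + 1)) (y : PhaseSpace (N + 1)), |y.2 i| ≤ (1 / 2 + 1 / (1 / (4 * T))) *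
      Real.exp (1 / (4 * T) * (pinnedChain ω₂ lam β γ).hamiltonian (N + 1) y) := fun i y =>
    CoherentDephasing.abs_momentum_le_exp hω.le hl.le hβ.le hϑ0 y i
  obtain ⟨K₂, hK₂⟩ : ∃ K, ∀ y, (1 + (pinnedChain ω₂ lam β γ).hamiltonian (N + 1) y) ^ 2 ≤
      K * Real.exp (1 / (4 * T) * (pinnedChain ω₂ lam β γ).hamiltonian (N + 1) y) :=
    ⟨_, fun y => LightConeBondHeat.one_add_pow_le_exp 2 (hH0 y) hϑ0⟩
  set Ca : ℝ := CΦ + |Φbar| with hCa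
  have hCa0 : 0 ≤ Ca := by rw [hCa]; positivity
  have hab : ∀ y : PhaseSpace (N + 1), |y.2 0 * ((ω₂ + 3 * lam * y.1 0 ^ 2 + 1 + 3 * β * (y.1 ⟨1, by omega⟩ - y.1 0) ^ 2) - Φbar)| ≤
      (Ca * K₂) * Real.exp (1 / (4 * T) * (pinnedChain ω₂ lam β γ).hamiltonian (N + 1) y) := by
    intro y
    rw [abs_mul]
    have hp : |y.2 0| ≤ 1 + (pinnedChain ω₂ lam β γ).hamiltonian (N + 1) y :=
      CoherentDephasing.MeanFieldDuhamel.abs_snd_le hl.le hβ.le γ hω.le y 0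
    have hΦ' := hgb y
    dsimp only at hΦ'
    calc |y.2 0| * |(ω₂ + 3 * lam * y.1 0 ^ 2 + 1 + 3 * β * (y.1 ⟨1, by omega⟩ - y.1 0) ^ 2) - Φbar| ≤
        (1 + (pinnedChain ω₂ lam β γ).hamiltonian (N + 1) y) * (Ca * (1 + (pinnedChain ω₂ lam β γ).hamiltonian (N + 1) y)) :=
          mul_le_mul hp hΦ' (abs_nonneg _) (by linarith [hH0 y])
      _ = Ca * (1 + (pinnedChain ω₂ lam β γ).hamiltonian (N + 1) y) ^ 2 := by ring
      _ ≤ Ca * (K₂ * Real.exp (1 / (4 * T) * (pinnedChain ω₂ lam β γ).hamiltonian (N + 1) y)) :=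
          mul_le_mul_of_nonneg_left (hK₂ y) hCa0
      _ = (Ca * K₂) * Real.exp (1 / (4 * T) * (pinnedChain ω₂ lam β γ).hamiltonian (N + 1) y) := by ring
  have hac : Continuous fun z : PhaseSpace (N + 1) => z.2 0 * ((ω₂ + 3 * lam * z.1 0 ^ 2 + 1 + 3 * β * (z.1 ⟨1, by omega⟩ - z.1 0) ^ 2) - Φbar) := by fun_prop
  have hI0 := CoherentDephasing.pinnedChain_corr_sq_integrableOn hω hl.le hβ hγ hNp hT hϑ0 h2ϑ
      (a := fun z : PhaseSpace (N + 1) => z.2 0) (g := fun y : PhaseSpace (N + 1) => y.2 0)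
      (by fun_prop) (by fun_prop) (hwb 0) (hwb 0) hp0
  have hIN := CoherentDephasing.pinnedChain_corr_sq_integrableOn hω hl.le hβ hγ hNp hT hϑ0 h2ϑ
      (a := fun z : PhaseSpace (N + 1) => z.2 (Fin.last N)) (g := fun y : PhaseSpace (N + 1) => y.2 0)
      (by fun_prop) (by fun_prop) (hwb (Fin.last N)) (hwb 0) hp0
  have hIA := CoherentDephasing.pinnedChain_corr_sq_integrableOn hω hl.le hβ hγ hNp hT hϑ0 h2ϑ
      (a := fun z : PhaseSpace (N + 1) => z.2 0 * ((ω₂ + 3 * lam * z.1 0 ^ 2 + 1 + 3 * β * (z.1 ⟨1, by omega⟩ - z.1 0) ^ 2) - Φbar))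
      (g := fun y : PhaseSpace (N + 1) => y.2 0) hac (by fun_prop) hab (hwb 0) hp0
  -- `M_N ≤ M`
  have hMN : ((∫ z, (z.2 0 * ((ω₂ + 3 * lam * z.1 0 ^ 2 + 1 + 3 * β * (z.1 ⟨1, by omega⟩ - z.1 0) ^ 2) - Φbar)) ^ 2
        ∂((pinnedChain ω₂ lam β γ).gibbsMeasure (N + 1) T)) +
      ∫ z, G₃ z ^ 2 ∂((pinnedChain ω₂ lam β γ).gibbsMeasure (N + 1) T)) / 2 ≤ M := by
    have e : ∫ z, (z.2 0 * ((ω₂ + 3 * lam * z.1 0 ^ 2 + 1 + 3 * β * (z.1 ⟨1, by omega⟩ - z.1 0) ^ 2) - Φbar)) ^ 2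
        ∂((pinnedChain ω₂ lam β γ).gibbsMeasure (N + 1) T) =
        T * ∫ z, ((ω₂ + 3 * lam * z.1 0 ^ 2 + 1 + 3 * β * (z.1 ⟨1, by omega⟩ - z.1 0) ^ 2) - Φbar) ^ 2
          ∂((pinnedChain ω₂ lam β γ).gibbsMeasure (N + 1) T) := ha2
    rw [e, hM]
    nlinarith [mul_le_mul_of_nonneg_left hVhi hT.le]
  -- the abstract core
  have key := shortTime_abstract (S := fnorm ω₂ lam β γ T N t)
      (m0 := fun s => ∫ z, z.2 0 * (∫ y, y.2 0
        ∂((pinnedChain ω₂ lam β γ).transitionKernel (N + 1) T T s.toNNReal z)) ∂((pinnedChain ω₂ lam β γ).gibbsMeasure (N + 1) T))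
      (mN := fun s => ∫ z, z.2 (Fin.last N) * (∫ y, y.2 0
        ∂((pinnedChain ω₂ lam β γ).transitionKernel (N + 1) T T s.toNNReal z)) ∂((pinnedChain ω₂ lam β γ).gibbsMeasure (N + 1) T))
      (A := fun s => ∫ z, (z.2 0 * ((ω₂ + 3 * lam * z.1 0 ^ 2 + 1 + 3 * β * (z.1 ⟨1, by omega⟩ - z.1 0) ^ 2) - Φbar)) * (∫ y, y.2 0
        ∂((pinnedChain ω₂ lam β γ).transitionKernel (N + 1) T T s.toNNReal z)) ∂((pinnedChain ω₂ lam β γ).gibbsMeasure (N + 1) T))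
      hγ hT hv₀ hVlo hVhi hM0 hMN ht htr (fnorm_nonneg ω₂ lam β γ T N t)
      (hI0.mono_set Ioc_subset_Ioi_self) (hIN.mono_set Ioc_subset_Ioi_self) (hIA.mono_set Ioc_subset_Ioi_self)
      hW henv
  -- read `mN = r_N` (kernel reflection) and `m0 = a_N` (site reflection of the echo)
  have hrefl : ∀ s, (∫ z, z.2 (Fin.last N) * (∫ y, y.2 0
        ∂((pinnedChain ω₂ lam β γ).transitionKernel (N + 1) T T s.toNNReal z)) ∂((pinnedChain ω₂ lam β γ).gibbsMeasure (N + 1) T)) =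
      pairCorr ω₂ lam β γ T N s := fun s =>
    (sa_reflect ω₂ lam β γ hω hl hβ hγ T hT N s).symm
  have hecho : ∀ s, (∫ z, z.2 0 * (∫ y, y.2 0
        ∂((pinnedChain ω₂ lam β γ).transitionKernel (N + 1) T T s.toNNReal z)) ∂((pinnedChain ω₂ lam β γ).gibbsMeasure (N + 1) T)) =
      ∫ z, z.2 (Fin.last N) * fcast ω₂ lam β γ T N s z ∂((pinnedChain ω₂ lam β γ).gibbsMeasure (N + 1) T) := fun s => by
    rw [echo_eq_momResp_zero ω₂ lam β γ hω hl.le hβ.le hγ.le T N s]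
    rfl
  have e : ∫ s in Ioc (0 : ℝ) t, ((∫ z, z.2 (Fin.last N) * (∫ y, y.2 0
        ∂((pinnedChain ω₂ lam β γ).transitionKernel (N + 1) T T s.toNNReal z)) ∂((pinnedChain ω₂ lam β γ).gibbsMeasure (N + 1) T)) ^ 2 +
      (∫ z, z.2 0 * (∫ y, y.2 0
        ∂((pinnedChain ω₂ lam β γ).transitionKernel (N + 1) T T s.toNNReal z)) ∂((pinnedChain ω₂ lam β γ).gibbsMeasure (N + 1) T)) ^ 2) =
      ∫ s in Ioc (0 : ℝ) t, ((pairCorr ω₂ lam β γ T N s) ^ 2 +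
        (∫ z, z.2 (Fin.last N) * fcast ω₂ lam β γ T N s z ∂((pinnedChain ω₂ lam β γ).gibbsMeasure (N + 1) T)) ^ 2) := by
    refine integral_congr_ae (ae_of_all _ fun s => ?_)
    simp only [hrefl s, hecho s]
  rw [e] at key
  simpa only [hc] using key

/-! ## All times: the coherent budget is non-increasing, so the defect persists -/

/-- **`N`-UNIFORM ANHARMONIC LOSS AT ALL TIMES.** With `c, r₀` as in `anharmonicShortTimeLoss`: for every `N ≥ 2` and EVERY
`t ≥ 0`, `S_N(t) + (2γ/T)∫₀ᵗ(r_N² + a_N²) ≤ T − c·(min t r₀)⁵` — the coherent budget identity of the harmonic corner fails by a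
fixed, `N`-independent amount from time `r₀` on (monotonicity of the coherent budget, `coherentBudget_antitone`). [folklore] -/
theorem anharmonicLoss_allTimes : ∀ ω₂ lam β γ : ℝ, 0 < ω₂ → 0 < lam → 0 < β → 0 < γ → ∀ T : ℝ, 0 < T → ∃ c r₀ : ℝ, 0 < c ∧ 0 < r₀ ∧ ∀ N : ℕ, 2 ≤ N → ∀ t : ℝ, 0 ≤ t → fnorm ω₂ lam β γ T N t + (2 * γ / T) * ∫ s in Ioc (0 : ℝ) t, ((pairCorr ω₂ lam β γ T N s) ^ 2 + (∫ z, z.2 (Fin.last N) * fcast ω₂ lam β γ T N s z ∂((pinnedChain ω₂ lam β γ).gibbsMeasure (N + 1) T)) ^ 2) ≤ T - c * (min t r₀) ^ 5 := by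
  intro ω₂ lam β γ hω hl hβ hγ T hT
  obtain ⟨c, r₀, hc, hr₀, h⟩ := anharmonicShortTimeLoss ω₂ lam β γ hω hl hβ hγ T hT
  refine ⟨c, r₀, hc, hr₀, fun N hN t ht => ?_⟩
  rcases le_or_gt t r₀ with htr | htr
  · rw [min_eq_left htr]; exact h N hN t ht htr
  · rw [min_eq_right htr.le]
    exact (coherentBudget_antitone ω₂ lam β γ hω hl.le hβ hγ T hT N r₀ t hr₀.le htr.le).trans (h N hN r₀ hr₀.le le_rfl)

end Summit.AtomisticToContinuum.FouriersLaw.Theorems.PhononMeanFreePath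

end
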